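import Summits.HodgeConjecture.CorCM.SexticOcticSlotFrameIndex
import HarnessLib

/-!
# A sextic slot against an octic slot, III: an element of order three fixing one side forces every common
# constituent to be a line

COR-CM (cell `pub-hodgecm2`, binder seat `b16` gen 47, count-neutral claim CM34-COMPLETE, file F3; theorems only, no
definition, no named fact, no `sorry`).  Setting of `SexticOcticSlotOrderThree` / `SexticOcticSlotFrameIndex`: `G` acts
on `X` (`|X| = 6`) and `Y` (`|Y| = 8`) with a commuting conjugation `ρ`; a COMMON CONSTITUENT of the two slots is a
`G`-stable subspace `P` of the `ρ`-odd weights on `X` with a linear `T : ℚ^X → ℚ^Y`, `G`-equivariant and injective on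
`P`, with odd values (the hypothesis shape of `CMTypeRankCommonConstituent.map_slotExt_antiSpan_le_of_pairwise`).  The
element of order `3` of F1 may act trivially on one of the two sides; in both cases the constituent is at most a LINE:

* §1 **`finrank_le_one_of_fixing_octic`** — `c` cycles the three pairs of `X` and fixes `Y` pointwise: every `p ∈ P`
  has `T(p∘c) = (Tp)∘c = Tp`, so `p∘c = p`, i.e. `p(x₀) = p(cx₀) = p(c²x₀)`; `p ↦ p(x₀)` is injective on `P`.
* §2 **`finrank_le_one_of_fixing_sextic`** — `d` fixes `X` pointwise and acts on `Y` with a fixed pair `{y₀, ρy₀}` and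
  three cycled pairs (`G` transitive on `Y`): every `q = Tp` is `d`-invariant, `q(y₁) = q(dy₁) = q(d²y₁)`; if
  `dim P ≥ 2` some `q = Tp₁ ≠ 0` vanishes at `y₁`, hence off the fixed pair, and a `g ∈ G` with `g y₁ = y₀` transports
  it to `q∘g = T(p₁∘g)`, which takes the value `q(y₀) ≠ 0` at `y₁` but `0` at `dy₁` (as `g d y₁ ∉ {y₀, ρy₀}`) — not
  `d`-invariant.

A line then carries a shared sign character (`SexticOcticSlotFrameIndex.exists_shared_eigen_of_finrank_eq_one`), read
on CM fields as a shared imaginary quadratic subfield (`CorCM/SharedSignCharacterQuadraticSubfield`).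

## References

* [Dodson1984] B. Dodson, *The structure of Galois groups of CM-fields*, Trans. AMS 283 (1984), §5.1.1–§5.1.2.
* [Gordon1999HodgeAVSurvey] B. B. Gordon, *A survey of the Hodge conjecture for abelian varieties*, §3 Theorem (proof).
-/

noncomputable section

namespace Summit.HodgeConjecture.CorCM.SexticOctic

open Literature.NumberTheory.ComplexMultiplication

variable {G : Type*} [Group G] {X Y : Type*} [MulAction G X] [MulAction G Y] {ρ : G}

/-! ## §1 The element of order three cycles the sextic pairs and fixes the octic side -/

/-- **If `c` cycles the three pairs of `X` and fixes `Y` pointwise, every common constituent is at most a line.**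
For `p ∈ P`: `T(p∘c) = (Tp)∘c = Tp`, so `p∘c = p` by injectivity, whence `p(cx₀) = p(x₀)`, `p(c²x₀) = p(x₀)`; an odd
weight with these values is determined by `p(x₀)`, so `p ↦ p(x₀)` embeds `P` in `ℚ`.
[cite: Gordon1999HodgeAVSurvey, §3 Theorem (proof)] [cite: Dodson1984, §5.1.2] -/
theorem finrank_le_one_of_fixing_octic {e : Fin 6 → X} (hsurj : Function.Surjective e)
    (hρe : ∀ i, ρ • e i = e (![3, 4, 5, 0, 1, 2] i)) {c : G} (hce : ∀ i, c • e i = e (![1, 2, 0, 4, 5, 3] i))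
    (hcY : ∀ y : Y, c • y = y) {P : Submodule ℚ (X → ℚ)} (hPanti : P ≤ antiWeights (E := X) ρ)
    (hPst : ∀ g : G, ∀ f ∈ P, (fun x => f (g • x)) ∈ P) (T : (X → ℚ) →ₗ[ℚ] (Y → ℚ))
    (hT : ∀ g : G, ∀ f ∈ P, T (fun x => f (g • x)) = fun y => T f (g • y))
    (hTinj : ∀ f ∈ P, T f = 0 → f = 0) : Module.finrank ℚ P ≤ 1 := by
  by_contra hlt
  have h2 : 2 ≤ Module.finrank ℚ P := by omega
  obtain ⟨p, hpP, hp0, hpe⟩ :=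
    exists_mem_ne_zero_map_eq_zero h2 (LinearMap.proj (R := ℚ) (φ := fun _ : X => ℚ) (e 0))
  have hpe0 : p (e 0) = 0 := hpe
  -- `p ∘ c = p`
  have hfix : (fun x => p (c • x)) = p := by
    have h1 : T ((fun x => p (c • x)) - p) = 0 := by
      rw [map_sub, hT c p hpP, sub_eq_zero]
      funext y
      rw [hcY]
    have h2 := hTinj _ (P.sub_mem (hPst c p hpP) hpP) h1
    exact sub_eq_zero.1 h2
  have hpe1 : p (e 1) = 0 := by
    have := congrFun hfix (e 0)
    rw [hce] at this
    simpa [hpe0] using this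
  have hpe2 : p (e 2) = 0 := by
    have := congrFun hfix (e 1)
    rw [hce] at this
    simpa [hpe1] using this
  exact hp0 (eq_zero_of_frame₆ hsurj hρe (hPanti hpP) hpe0 hpe1 hpe2)

/-! ## §2 The element of order three fixes the sextic side and cycles three octic pairs -/

/-- **If `d` fixes `X` pointwise and acts on `Y` (transitively permuted by `G`) with one fixed pair and three cycled
pairs, every common constituent is at most a line.**  Every `q = Tp` is `d`-invariant (`q(dy) = q(y)`); with `dim P ≥ 2`
some `q = Tp₁ ≠ 0` vanishes at `y₁`, hence on the six moved points, so `q(y₀) ≠ 0`; for `g y₁ = y₀` the translate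
`q∘g = T(p₁∘g)` takes the value `q(y₀)` at `y₁` and `0` at `dy₁` (since `g d y₁ ∉ {y₀, ρy₀}`), contradicting
`d`-invariance. [cite: Gordon1999HodgeAVSurvey, §3 Theorem (proof)] [cite: Dodson1984, §5.1.1] -/
theorem finrank_le_one_of_fixing_sextic [MulAction.IsPretransitive G Y] {e : Fin 8 → Y} (he : Function.Injective e)
    (hsurj : Function.Surjective e) (hρe : ∀ i, ρ • e i = e (![1, 0, 5, 6, 7, 2, 3, 4] i))
    (hcomm : ∀ (g : G) (y : Y), g • ρ • y = ρ • g • y) {d : G} (hde : ∀ i, d • e i = e (![0, 1, 3, 4, 2, 6, 7, 5] i))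
    (hdX : ∀ x : X, d • x = x) {P : Submodule ℚ (X → ℚ)} (hPst : ∀ g : G, ∀ f ∈ P, (fun x => f (g • x)) ∈ P)
    (T : (X → ℚ) →ₗ[ℚ] (Y → ℚ)) (hT : ∀ g : G, ∀ f ∈ P, T (fun x => f (g • x)) = fun y => T f (g • y))
    (hTanti : ∀ f ∈ P, T f ∈ antiWeights (E := Y) ρ) (hTinj : ∀ f ∈ P, T f = 0 → f = 0) :
    Module.finrank ℚ P ≤ 1 := by
  by_contra hlt
  have h2 : 2 ≤ Module.finrank ℚ P := by omega
  obtain ⟨p₁, hp₁P, hp₁0, hp₁e⟩ := exists_mem_ne_zero_map_eq_zero h2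
    ((LinearMap.proj (R := ℚ) (φ := fun _ : Y => ℚ) (e 2)).comp T)
  have hq2 : T p₁ (e 2) = 0 := hp₁e
  -- every `T p`, `p ∈ P`, is `d`-invariant
  have hinv : ∀ p ∈ P, ∀ y : Y, T p (d • y) = T p y := by
    intro p hp y
    have h1 : (fun x => p (d • x)) = p := funext fun x => by rw [hdX]
    have h2 := hT d p hp
    rw [h1] at h2
    exact (congrFun h2 y).symm
  have hq3 : T p₁ (e 3) = 0 := by
    have := hinv p₁ hp₁P (e 2)
    rw [hde] at this
    simpa [hq2] using this
  have hq4 : T p₁ (e 4) = 0 := by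
    have := hinv p₁ hp₁P (e 3)
    rw [hde] at this
    simpa [hq3] using this
  have hq0 : T p₁ (e 0) ≠ 0 := fun h0 =>
    hp₁0 (hTinj p₁ hp₁P (eq_zero_of_frame₈ hsurj hρe (hTanti p₁ hp₁P) h0 hq2 hq3 hq4))
  -- the value vector of `q = T p₁` on the frame
  have hval : ∀ i, T p₁ (e i) = ![T p₁ (e 0), -T p₁ (e 0), 0, 0, 0, 0, 0, 0] i := by
    intro i
    rw [apply_frame₈ hρe (hTanti p₁ hp₁P) i]
    fin_cases i <;> simp [hq2, hq3, hq4]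
  -- transport by `g` with `g y₁ = y₀`
  obtain ⟨g, hg⟩ := MulAction.exists_smul_eq G (e 2) (e 0)
  obtain ⟨π, hπ, hπinj, hπr⟩ := exists_indexMap he hsurj hρe hcomm g
  have hπ2 : π 2 = 0 := he (by rw [← hπ 2, hg])
  have hπ5 : π 5 = 1 := by have := hπr 2; simp only [Matrix.cons_val] at this; rw [this, hπ2]; rfl
  have hπ3 : π 3 ≠ 0 := fun h => absurd (hπinj (h.trans hπ2.symm)) (by decide)
  have hπ3' : π 3 ≠ 1 := fun h => absurd (hπinj (h.trans hπ5.symm)) (by decide)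
  -- `T(p₁ ∘ g) = (T p₁) ∘ g` is `d`-invariant: compare its values at `y₁` and `d y₁`
  have hinv' := hinv _ (hPst g p₁ hp₁P) (e 2)
  rw [hT g p₁ hp₁P] at hinv'
  simp only at hinv'
  rw [hde, hπ, hπ] at hinv'
  simp only [Matrix.cons_val] at hinv'
  rw [hπ2, hval, hval] at hinv'
  -- right-hand side is `q(y₀) ≠ 0`, left-hand side is `q(e (π 3)) = 0`
  generalize π 3 = k at hπ3 hπ3' hinv'
  fin_cases k <;> simp at hπ3 hπ3' hinv' <;> exact hq0 (by linarith)

end Summit.HodgeConjecture.CorCM.SexticOctic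

end
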